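import Summits.CriticalPhenomena.PercolationContinuityZ3.Theorems.Transplant.GrigorchukSuperpolynomialGrowthAllGens
import Summits.CriticalPhenomena.PercolationContinuityZ3.Theorems.Transplant.GrigorchukCriticalProbLtOne
import Summits.CriticalPhenomena.PercolationContinuityZ3.Theorems.Transplant.AutCocompactAnyStabilizers
import Literature.GroupTheory.Nilpotent.PolynomialGrowthVirtuallyNilpotent
import HarnessLib

/-!
# NO virtually nilpotent group acts with finitely many orbits by automorphisms on ANY Cayley graph of the first Grigorchuk group `𝔊` —
# rung Q is absent AT THE LEVEL OF `Aut(Cay(𝔊; S))`, not only of subgroups of `𝔊` (Wolf-type growth transfer vs. Grigorchuk's superpolynomial lower bound)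

builds on p205010 (kernel theorem, internal audit signed; external expert review pending) — nothing in this file uses p205010.  NEGATIVE (scope) record about the
INPUT of the quasi-step node's action customers (`AutCyl.conj4_of_virtuallyNilpotent_cocompact` &c. need a virtually nilpotent group acting with finitely many
orbits); no percolation statement; nothing about any `@[conjecture]` node, in particular nothing about `BenjaminiSchramm1996_conj4_endState` or
`BenjaminiSchramm1996_conj4_amenableSubexponential`; `θ(p_c) = 0` on `Cay(𝔊; S)` stays NOT PROVED (tree and print).  Lane `prim-bschramm`, seat
`prim-bschramm-stmt` gen 39 (lead g26 RULING N5 #8047, N5b; refuter p5-g31 #8046 (3)).  Helper file (`--supports stmt-CriticalPhenomena-4575 --as helper`).  Def-free.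

CONTENT — the Aut-level twin, for `𝔊` itself, of «GrigorchukLamplighterAutNotVirtuallyNilpotent» (p615715, B–E's graph):
* §1 `AutCyl.exists_polynomialGrowth_of_virtuallyNilpotent_cocompact` — GROWTH TRANSFER, finite-generation-free: a group `A` with a finite-index nilpotent
  subgroup acting by automorphisms with finitely many orbits on a CONNECTED locally finite graph `X` forces `|B_X(x, n)| ≤ C (n + 1)^D` (real constants,
  uniformly in `x`).  The action restricts to the finitely generated `H = closure S` of F1's section set («AutCocompactAnyStabilizers»
  `AutCyl.exists_finset_closure_smul_reps`, same representatives), `|B_X(x, n)| ≤ |reps| · |B_{Cay(H; T)}(1, n)|` for a finite `T ⊆ H` («AutCocompactGrowth»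
  `AutChart.exists_finset_ballVolume_le_card_mul`), and `Cay(H; T)` grows polynomially by Wolf's theorem for the finitely generated virtually nilpotent `H`
  (Literature «PolynomialGrowthVirtuallyNilpotent» `exists_ballVolume_mulCayley_le_rpow_of_fg`, applied to `N ⊓ H ≤ H`).  Not a restatement of either input:
  the new content is the FG-free packaging in the real currency that the lane's growth hypotheses use.
* §2 **`Grigorchuk.cayley_no_virtuallyNilpotent_finite_orbits`**: for every finite GENERATING `S ⊆ 𝔊`, no group with a finite-index nilpotent subgroup acts on
  `𝔊` by automorphisms of `Cay(𝔊; S)` with finitely many orbits — §1 would bound the balls of `Cay(𝔊; S)` polynomially, contradicting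
  `Grigorchuk.not_polynomialGrowth_cayley_gens` («GrigorchukSuperpolynomialGrowthAllGens» p619845); `cayley_no_isVirtuallyNilpotent_finite_orbits` (the
  `Group.IsVirtuallyNilpotent` form) and the standard-generating-set forms `cayley_gens_no_…` (via `closure_gens_finset`, p607347).  The group-level
  statement `not_isVirtuallyNilpotent_grigorchukGroup` (p615715, left translations = one orbit) is the special case `A = 𝔊`; it is not re-proved here.
[cite: Grigorchuk1984, Thm. (lower bound; 𝔊 commensurable with 𝔊 × 𝔊)] [cite: WolfGrowth1968, Thm. 3.2; §3 (finite index)]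
[cite: Woess2000, Prop. 3.9, Lemma 3.13 (cocompact actions: growth of the graph = growth of the group)] [cite: BenjaminiSchramm1996, Conj. 4; §2 (almost transitive graphs)]
-/

noncomputable section

namespace Summit.CriticalPhenomena.PercolationContinuityZ3.Theorems.Transplant

open SimpleGraph Literature.Barriers.CriticalPhenomena Literature.Probability.Percolation Literature.GroupTheory.Nilpotent
open scoped Classical

/-! ### §1 Growth transfer along a cocompact action of a virtually nilpotent group (no finite-generation hypothesis) -/

namespace AutCyl

variable {W : Type} {X : SimpleGraph W} {A : Type} [Group A] [MulAction A W]

/-- **A cocompact action by automorphisms of a group with a finite-index NILPOTENT subgroup on a connected locally finite graph forces POLYNOMIAL GROWTH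
of the graph** (real constants, uniform in the base point): restrict to the finitely generated subgroup generated by the sections (same representatives),
transfer growth along the action, and apply Wolf's theorem to that finitely generated virtually nilpotent group.  `A` itself need not be finitely generated.
[cite: WolfGrowth1968, Thm. 3.2; §3 (finite index)] [cite: Woess2000, Prop. 3.9, Lemma 3.13] -/
theorem exists_polynomialGrowth_of_virtuallyNilpotent_cocompact [X.LocallyFinite] (hc : X.Connected) (hact : IsActionByAut X A)
    (reps : Finset W) (hcover : ∀ w : W, ∃ a : A, ∃ r ∈ reps, a • r = w) (N : Subgroup A) [N.FiniteIndex] [Group.IsNilpotent N] :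
    ∃ C D : ℝ, ∀ (x : W) (n : ℕ), (ballVolume X x n : ℝ) ≤ C * ((n : ℝ) + 1) ^ D := by
  obtain ⟨S, hS⟩ := exists_finset_closure_smul_reps hact hc reps hcover
  set H : Subgroup A := Subgroup.closure (S : Set A) with hH
  have hcoverH : ∀ w : W, ∃ a : H, ∃ r ∈ reps, a • r = w := fun w => by
    obtain ⟨a, ha, r, hr, hw⟩ := hS w
    exact ⟨⟨a, ha⟩, r, hr, hw⟩
  -- `N ⊓ H` inside `H` is nilpotent (it is `H ⊓ N` inside the nilpotent `N`) and of finite index; `H` is finitely generated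
  let e : H.subgroupOf N ≃* N.subgroupOf H :=
    { toFun := fun y => ⟨⟨((y : N) : A), Subgroup.mem_subgroupOf.1 y.2⟩, Subgroup.mem_subgroupOf.2 (y : N).2⟩
      invFun := fun z => ⟨⟨((z : H) : A), Subgroup.mem_subgroupOf.1 z.2⟩, Subgroup.mem_subgroupOf.2 (z : H).2⟩
      left_inv := fun y => rfl
      right_inv := fun z => rfl
      map_mul' := fun y z => rfl }
  haveI : Group.IsNilpotent (N.subgroupOf H) := Group.nilpotent_of_mulEquiv e
  -- growth transfer along the restricted action, then Wolf for the finitely generated virtually nilpotent `H`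
  obtain ⟨T, hT⟩ := AutChart.exists_finset_ballVolume_le_card_mul (isActionByAut_subgroup hact H) reps hcoverH
  obtain ⟨C, D, hCD⟩ := exists_ballVolume_mulCayley_le_rpow_of_fg T (N.subgroupOf H)
  refine ⟨reps.card * C, D, fun x n => ?_⟩
  have h1 : (ballVolume X x n : ℝ) ≤ reps.card * (ballVolume (mulCayley (↑T : Set H)) 1 n : ℝ) := by exact_mod_cast hT x n
  calc (ballVolume X x n : ℝ) ≤ reps.card * (ballVolume (mulCayley (↑T : Set H)) 1 n : ℝ) := h1
    _ ≤ reps.card * (C * (((n : ℝ) + 1) ^ D)) := mul_le_mul_of_nonneg_left (hCD 1 n) (Nat.cast_nonneg _)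
    _ = reps.card * C * ((n : ℝ) + 1) ^ D := by ring

end AutCyl

/-! ### §2 No virtually nilpotent group acts with finitely many orbits on a Cayley graph of `𝔊` -/

namespace Grigorchuk

variable {A : Type} [Group A] [MulAction A ↥grigorchukGroup]

/-- **(N5b) NO GROUP WITH A FINITE-INDEX NILPOTENT SUBGROUP ACTS ON `𝔊` BY AUTOMORPHISMS OF `Cay(𝔊; S)` WITH FINITELY MANY ORBITS**, for every finite
generating `S` — the input of the quasi-step node's action customers (rung Q) is absent from every Cayley graph of `𝔊` at the level of `Aut(Cay)`: such an
action would make `Cay(𝔊; S)` grow polynomially (§1), against Grigorchuk's superpolynomial lower bound (`not_polynomialGrowth_cayley_gens`, p619845).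
`θ(p_c) = 0` on these graphs stays NOT PROVED. [cite: Grigorchuk1984, Thm. (lower bound)] [cite: WolfGrowth1968, Thm. 3.2] [cite: BenjaminiSchramm1996, Conj. 4; §2] -/
theorem cayley_no_virtuallyNilpotent_finite_orbits (S : Finset ↥grigorchukGroup) (hS : Subgroup.closure (↑S : Set ↥grigorchukGroup) = ⊤)
    (hact : IsActionByAut (mulCayley (↑S : Set ↥grigorchukGroup)) A) (R : Finset ↥grigorchukGroup)
    (hRc : ∀ γ : ↥grigorchukGroup, ∃ a : A, ∃ r ∈ R, a • r = γ) (N : Subgroup A) [N.FiniteIndex] : ¬ Group.IsNilpotent N := by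
  intro hN
  exact not_polynomialGrowth_cayley_gens S hS
    (AutCyl.exists_polynomialGrowth_of_virtuallyNilpotent_cocompact (CayleyScaled.connected_mulCayley_of_closure S hS) hact R hRc N)

/-- **… `Group.IsVirtuallyNilpotent` form**: no virtually nilpotent group acts on `𝔊` by automorphisms of `Cay(𝔊; S)`, `S` finite generating, with finitely
many orbits. [cite: Grigorchuk1984, Thm. (lower bound)] [cite: BenjaminiSchramm1996, Conj. 4; §2] -/
theorem cayley_no_isVirtuallyNilpotent_finite_orbits (S : Finset ↥grigorchukGroup) (hS : Subgroup.closure (↑S : Set ↥grigorchukGroup) = ⊤)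
    (hact : IsActionByAut (mulCayley (↑S : Set ↥grigorchukGroup)) A) (R : Finset ↥grigorchukGroup)
    (hRc : ∀ γ : ↥grigorchukGroup, ∃ a : A, ∃ r ∈ R, a • r = γ) : ¬ Group.IsVirtuallyNilpotent A := by
  rintro ⟨K, hK, hfi⟩
  haveI := hfi
  exact cayley_no_virtuallyNilpotent_finite_orbits S hS hact R hRc K hK

/-- **The standard Cayley graph `Cay(𝔊; a, b, c, d)`**: no group with a finite-index nilpotent subgroup acts on it by automorphisms with finitely many
orbits. [cite: Grigorchuk1984, Thm. (lower bound)] [cite: BenjaminiSchramm1996, Conj. 4; §2] -/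
theorem cayley_gens_no_virtuallyNilpotent_finite_orbits
    (hact : IsActionByAut (mulCayley (↑({aG, bG, cG, dG} : Finset ↥grigorchukGroup) : Set ↥grigorchukGroup)) A) (R : Finset ↥grigorchukGroup)
    (hRc : ∀ γ : ↥grigorchukGroup, ∃ a : A, ∃ r ∈ R, a • r = γ) (N : Subgroup A) [N.FiniteIndex] : ¬ Group.IsNilpotent N :=
  cayley_no_virtuallyNilpotent_finite_orbits _ closure_gens_finset hact R hRc N

/-- … and no virtually nilpotent group acts on `Cay(𝔊; a, b, c, d)` by automorphisms with finitely many orbits.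
[cite: Grigorchuk1984, Thm. (lower bound)] [cite: BenjaminiSchramm1996, Conj. 4; §2] -/
theorem cayley_gens_no_isVirtuallyNilpotent_finite_orbits
    (hact : IsActionByAut (mulCayley (↑({aG, bG, cG, dG} : Finset ↥grigorchukGroup) : Set ↥grigorchukGroup)) A) (R : Finset ↥grigorchukGroup)
    (hRc : ∀ γ : ↥grigorchukGroup, ∃ a : A, ∃ r ∈ R, a • r = γ) : ¬ Group.IsVirtuallyNilpotent A :=
  cayley_no_isVirtuallyNilpotent_finite_orbits _ closure_gens_finset hact R hRc

end Grigorchuk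

end Summit.CriticalPhenomena.PercolationContinuityZ3.Theorems.Transplant

end
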